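import Literature.Probability.RandomPlanarGeometry.SAWTriangularConnectiveConstantLower12
import HarnessLib

/-!
# `μ(𝕋) > 3.94`: the irreducible-bridge certificate of `SAWTriangularConnectiveConstantLower.lean` at length `13`

Topic `Literature/Probability/RandomPlanarGeometry` (continues `SAWTriangularConnectiveConstantLower12.lean`: the
verified acceptance test `TriIrrCert.WordOK`, the list certificate `TriIrrCert.certL` with its soundness
`TriIrrCert.le_of_certL` (standard axioms), the symmetry-halved untrusted search `TriIrrCert.dfsSym`, and the
certified counts `λ_n(𝕋) ≥ 3, 0, 4, 12, 20, 90, 242, 856, 2890, 10088, 35988, 129614` for `n ≤ 12`). One more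
evaluation, `λ_13(𝕋) ≥ 473 362` (the exact value: the renewal inversion of `b_13(𝕋) = 26 310 873`), kept in its own
file because its `native_decide` is the expensive one (about twice the work of `n = 12`), and the resulting numeral:
`Σ_{n ≤ 13} λ_n(𝕋) (50/197)^n ≥ 1.0046 > 1`, hence **`μ(𝕋) > 197/50 = 3.94`** by the certificate principle
`inv_lt_exp_logMuTri_of_one_lt_sum` (Kesten's inequality `Σ_n λ_n μ^{-n} ≤ 1`, Madras–Slade (4.2.3)–(4.2.4); the
method of Jensen 2004 §2, whose series reach `4.118935`; ours is weaker but kernel-checked). The truncation at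
`n ≤ 13` cannot certify `3.95` (its root is `3.9485`). Computational class: axioms standard plus the `native_decide`
count certificates (`Lean.ofReduceBool`).
-/

open Finset
open scoped BigOperators

namespace Literature.Probability.RandomPlanarGeometry.SAW

namespace TriIrrCert

/-! ### The evaluation at `n = 13` (computational class) -/

/-- `λ_13(𝕋) ≥ 473362`. [cite: Jensen2004SAWLowerBounds, §2] [cite: MadrasSlade1993, Definition 4.2.1 (p. 89)] -/
theorem le_lambda_thirteen : 473362 ≤ brickIrreducibleBridgeCount 13 :=
  le_of_certL (L := dfsSym 13) (by native_decide)

end TriIrrCert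

/-! ### The numeral -/

open TriIrrCert in
/-- **`μ(𝕋) > 3.94`**: `197/50 < exp logMuTri`, from `Σ_{n ≤ 13} λ_n(𝕋) (50/197)^n > 1` and Kesten's
inequality. [cite: Jensen2004SAWLowerBounds, §2 (Kesten's method; `4.118935 < μ_tri`)] [cite: Alm2005, §5.5.1]
[cite: Kesten1963SAW, §4] [cite: MadrasSlade1993, §4.2, eq. (4.2.3)–(4.2.4) (pp. 90–91)] -/
theorem exp_logMuTri_gt_197_div_50 : (197 : ℝ) / 50 < Real.exp logMuTri := by
  have hx : (0 : ℝ) < 50 / 197 := by norm_num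
  have key : (1 : ℝ) < ∑ k ∈ Finset.range 14, (brickIrreducibleBridgeCount k : ℝ) * (50 / 197) ^ k := by
    have h1 : (3 : ℝ) ≤ brickIrreducibleBridgeCount 1 := by exact_mod_cast three_le_lambda_one
    have h2 : (0 : ℝ) ≤ brickIrreducibleBridgeCount 2 := Nat.cast_nonneg _
    have h3 : (4 : ℝ) ≤ brickIrreducibleBridgeCount 3 := by exact_mod_cast four_le_lambda_three
    have h4 : (12 : ℝ) ≤ brickIrreducibleBridgeCount 4 := by exact_mod_cast le_lambda_four
    have h5 : (20 : ℝ) ≤ brickIrreducibleBridgeCount 5 := by exact_mod_cast le_lambda_five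
    have h6 : (90 : ℝ) ≤ brickIrreducibleBridgeCount 6 := by exact_mod_cast le_lambda_six
    have h7 : (242 : ℝ) ≤ brickIrreducibleBridgeCount 7 := by exact_mod_cast le_lambda_seven
    have h8 : (856 : ℝ) ≤ brickIrreducibleBridgeCount 8 := by exact_mod_cast le_lambda_eight
    have h9 : (2890 : ℝ) ≤ brickIrreducibleBridgeCount 9 := by exact_mod_cast le_lambda_nine
    have h10 : (10088 : ℝ) ≤ brickIrreducibleBridgeCount 10 := by exact_mod_cast le_lambda_ten
    have h11 : (35988 : ℝ) ≤ brickIrreducibleBridgeCount 11 := by exact_mod_cast le_lambda_eleven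
    have h12 : (129614 : ℝ) ≤ brickIrreducibleBridgeCount 12 := by exact_mod_cast le_lambda_twelve
    have h13 : (473362 : ℝ) ≤ brickIrreducibleBridgeCount 13 := by exact_mod_cast le_lambda_thirteen
    simp only [Finset.sum_range_succ, Finset.sum_range_zero, brickIrreducibleBridgeCount_zero, Nat.cast_zero,
      zero_mul, zero_add, pow_one]
    norm_num
    linarith [h1, h2, h3, h4, h5, h6, h7, h8, h9, h10, h11, h12, h13]
  have := inv_lt_exp_logMuTri_of_one_lt_sum _ hx key
  rwa [inv_div] at this

/-- `log 3.94 < log μ(𝕋)`. [cite: Jensen2004SAWLowerBounds, §2] -/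
theorem log_197_div_50_lt_logMuTri : Real.log ((197 : ℝ) / 50) < logMuTri := by
  have h := Real.log_lt_log (by norm_num) exp_logMuTri_gt_197_div_50
  rwa [Real.log_exp] at h

end Literature.Probability.RandomPlanarGeometry.SAW
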